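import Summits.QuantumFields.YangMills.Theorems.BalabanUVNodesN12AtTheta13OfThm1CCMOfStepR
import Summits.QuantumFields.YangMills.Theorems.BalabanUVNodesK0ROfStepTokensRCube
import Literature.MathematicalPhysics.QuantumFieldTheory.Balaban1983to89.Node00.Record13SepCoPInhabitedOfThm1CCMWGaugeRSignFree
import Literature.MathematicalPhysics.QuantumFieldTheory.Balaban1983to89.Node00.Record13SepCoPLiveSelector

/-!
# BalabanUVNodes ∕ N12 — THE K0⁷ → K1⁷ JUNCTION ON THE SIGN-FREE ROAD (plan V17): the K1⁷ v5 rung body (N12 and N13 resolved) and its N12 restriction at the door-cured window-edition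
# witness `θ₁₅ᶜᶜᴹ(3;γ)(B₃, B₉·B₃, a₀, min a₁ (a₀''∕B₃))` with the K-side input = stub 1 ([15] Prop. 8's top step), stub 2 ([6] Prop. 6 at NODE 00's member), the SIGN-FREE stub's conclusion
# (NODE O's window `γ ∈ ]0,½]` and a TWO-SIDED box `bl ≤ β ≤ β′` of β at the witness, `bl` of either sign — [I] Thm 2's «uniformly bounded») and `4 ≤ F.m` — N12's RUNG-LEVEL K-side does NOT read
# the sign of β (Track A, DAG node N12 = [B15, Balaban1989LargeFieldI] CMP **122** (1989) 175–202; cluster K1 — K1⁷ `StabilityBAtRecordR13SepCoPH` = stmt-QuantumFields-20542, helper; seat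
# `pub-ymgap-dag-n12-d` g14 (R134 s2 «knit at the record»), 2026-08-27; count-neutral, CONDITIONAL, NOT a discharge)

HONEST FRAMING.  Count-neutral kernel COMPOSITION BY NAME — the sign-free twin of 12Z″ `…N12AtTheta13OfThm1CCMWCubeOfStubs` §0–§2 after plan g77's SIGNFREE-WORD (bus l.22622, node O P3 EVIDENCE-N78
«K0 does not read the sign of β»; V16 = 3ˢ, V17 = sign-free 3ᴬ «∃ γ₀ ε₀ ε₂₉ β′, … BetaLowerH (−β′) γ₀ β ∧ BetaUpperH β′ γ₀ β» REGISTERED 20:44Z, skeleton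
`K0Skeleton13SepCoPHV17` a3de99364626bf60, stub `stub_absBetaBoxAtThm1WitnessCCM13`; a V17 closer turns 3ᴬ's `(γ₀, ε₀, ε₂₉, β′)` into the letters below by dag-n21-c Cʷ′'s
`windowLettersBox_of_absBetaBox` ∕ Dʷ `exists_window_letters_signFree` + `box_mono` — `bl := −β′`, `γ := ` a shrunk window with `−bl·γ² ≤ 3`, `β′·γ² ≤ ¾`): the K1-side input `hP := §0` is K0a's `provisos₁₃SepCoP_theta13LiveOfNumerics_of_bgSepCoP`
∘ dag-n21-c Eʷ `bgSepCoPAt_theta13OfThm1CCMW_of_thm1GaugeR_of_hcomp` (the background row from (8), the R gauge sentence and the two COMPARABILITY clauses — no monotonicity) ∘ Dʷ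
`hcompBoth_theta13OfThm1CCMW_of_betaBoxSignFree_half` (both comparability clauses from the two-sided box, `−bl·γ² ≤ 3`, `β′·γ² ≤ ¾`) ∘ B′ ∘ C `gauge9R_cube_of_prop8TopStep_of_prop6Member` ∘ dag-n07-e
`variationalThm1RegSepCoP7M_of_prop8TopStep` ∘ A2's collar lemma ∘ C's signs; §1∕§2 instantiate this seat's GENERIC door-cured sockets 12T-H §2 ∕ 12V-H §4 at `Θ := theta13OfNumerics …
(stage12NumericsOfThm1CCMW F.L 3 γ ε₀ B₃ B₃' a₀ a₁') …` exactly as 12Z″ did.  WHY ONLY §0–§2: the ΛΩχZ-pinned rung (12Z″ §3, 12Z⁗) READS THE SIGN of β through the coupling step of the (1.89) pin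
(12N; `β ≥ 0` along the history) — on the sign-free road that input stays N12's displayed NODE O letter (sequel file), while the rung body with N12's (1.80)∕(1.89) rows as RAW displays (§1) and the
N12-restricted rung (§2) need NO sign.  The witness letters `B₃' = B₉·B₃`, `a₁' = min a₁ (a₀''∕B₃)` enter as display equations (`subst`).  WHICH CHILD BLOCKS: stub 1 `hB₃ ha₀ ha₁ h8` (N07),
stub 2 `hB₁ hc₁ hP6` (N05∕N06 junction β), the sign-free stub `hγ0 hγh hε hε' hβlo hβhi hl hu` ([I] Thm 2 content, proof unpublished — B12-THM2 lane ∕ node O's jets-free pair via N26), `hm : 4 ≤ F.m`;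
the S-bound world binding; rows h05S–h11 ∕ hUV; N12's layer `lamW` with `hsel`, the mixed pin `hW ∕ hWdeg`, and N12's per-run displays below the torus ((1.100) pin, live-mass — NODE 00 —, Prop. 1 —
dag-n12-c ∕ 12Q⁵ —, (1.80), (1.89) — dag-n12-e's pins).  Nothing of Bałaban's is asserted; every printed fact is a hypothesis; N12 is NOT discharged; no node is discharged; K0⁷ ∕ K1⁷ NOT closed;
counts unmoved (discharged 5∕27 · Track A 5∕28).  ONE finite four-torus programme at fixed `ε = L^{-K}` — nothing continuum ∕ ℝ⁴ ∕ OS ∕ mass gap ∕ Clay.  No `sorry`, `def`, `instance`, `notation`.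

Sources: [Balaban1989LargeFieldI] (0.2)–(0.6) p.176, Prop. 1 (1.78) p.194, (1.80) p.195, (1.89) p.198, (1.99)–(1.102) pp.200–201; [Balaban1989LargeFieldII] Thm 1 + (0.1) pp.355–356, (1.4) p.357;
[Balaban1988Convergent] Thm 1 p.262, (2.4)–(2.13) pp.255–257, (3.16)–(3.25) pp.268–270; [Balaban1985Variational] Thm 1 (8)–(9) p.279, (144)–(152) pp.300–301, Prop. 8 p.304;
[Balaban1985RegularSpaces] (1.3)–(1.9) p.77, Prop. 6 p.99, (1.130) p.99; [Balaban1987RG1] Thm 1 p.259, Thm 2 p.259, (0.20)–(0.21) p.256, §1 (1.20)–(1.22) p.264.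
-/

noncomputable section

open MeasureTheory
open scoped Matrix.Norms.L2Operator

namespace Summit.QuantumFields.YangMills.BalabanUVNodes.N12AtTheta13OfThm1CCMWCubeOfStubsSignFree

open Literature.MathematicalPhysics.QuantumFieldTheory.Balaban1983to89
open Literature.MathematicalPhysics.QuantumFieldTheory.Balaban1983to89.T4Continuum (T4Family)
open Literature.MathematicalPhysics.QuantumFieldTheory.Balaban1983to89.DagBinding
open Literature.MathematicalPhysics.QuantumFieldTheory.Balaban1983to89.Node00
open FlowStep (BetaLowerH BetaUpperH)
open FlowStepRuns (genFlow)
open B15Claim189Assembly (new189 chiPP dom)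
open B15 (Prop1Printed Ineq180)
open B15.BasicStep (Claim189)
open B8Eq17ClassAkV1 (plaqsOf)
open B15RPrime1100OfRep (rPrimeDataOfSel)
open Summit.QuantumFields.YangMills.BalabanUVNodes.N12AtTheta13OfThm1CCM (kappa_nonneg_theta13OfThm1CCM E0_nonneg_theta13OfThm1CCM B0_nonneg_theta13OfThm1CCM)
open Summit.QuantumFields.YangMills.BalabanUVNodes.N12AtRecord13SepCoPHSockets (nodesAtSomeRecordS₁₃SepCoPH_of_upS_fourPinW₀_ofHistoryBlind_ofCured_liveRepin₁₃_of_massLive_of_hasResiduals)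
open Summit.QuantumFields.YangMills.BalabanUVNodes.N12AtRecord13SepCoPHS (exists_guarded_recordS₁₃SepCoPH_b15_main_pinnedN12_ofHistoryBlind_ofCured_liveRepin₁₃_of_massLive_of_hasResiduals)
open Summit.QuantumFields.YangMills.BalabanUVNodes.N12AtRecord13SepCoPHSocketsPinned (nodesAtSomeRecordS₁₃SepCoPH_of_upS_fourPinW₀_pinnedΛΩχZ_ofHistoryBlind_ofCured_liveRepin₁₃_of_massLive_of_hasResiduals)
open B15Claim189Assembly (Setting189 half)
open B15.PrelimIntegrations (Ineq191 Ineq195)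
open B15Chi124DetSets (E124)
open B15DeterminingSets (MSField)
open B14DomainGeom (Pt)
open GaugeGroup (dist1)
open GaugeField (plaqHol)
open B15Claim189PrintedConditions (omegaOfChain)
open B15Claim189PinsOfHistory (sitOfHist N0OfRecord₁₃ D189OfHist)
open B15Claim189LambdaPin (enlD)
open Summit.QuantumFields.YangMills.BalabanUVNodes.N07Thm1Top7FromProp8 (variationalThm1RegSepCoP7M_of_prop8TopStep)
open Summit.QuantumFields.YangMills.Theorems.K0ROfStepTokensRCube (shrunkCeiling_pos gauge9R_cube_of_prop8TopStep_of_prop6Member)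

variable {F : T4Family}

/-! ## §0 The v1.5 provisos of record at the window-edition witness from V16's stub letters (dag-n21-c Bʷ ∘ B′ ∘ A2ʷ ∘ C ∘ dag-n07-e) -/

section Helpers
variable {B₃ B₁ : ℝ}

/-- `0 < B₃` from stub 1's inhabitation floor `2L² ≤ B₃` (`L ≥ 2`). [cite: Balaban1985Variational, Thm 1 p.279 (bookkeeping)] -/
private theorem floor_pos (hB₃ : 2 * (F.L : ℝ) ^ 2 ≤ B₃) : 0 < B₃ :=
  lt_of_lt_of_le (mul_pos two_pos (pow_pos (by exact_mod_cast lt_trans Nat.zero_lt_one F.hL.2) 2)) hB₃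

/-- `0 ≤ B₃` from the floor. [cite: Balaban1985Variational, Thm 1 p.279 (bookkeeping)] -/
private theorem floor_nonneg (hB₃ : 2 * (F.L : ℝ) ^ 2 ≤ B₃) : 0 ≤ B₃ := (floor_pos hB₃).le

/-- `0 ≤ B₉·B₃` (FILE 29's `b9Of_pos`). [cite: Balaban1985Variational, (9) p.279, (152) p.301 (bookkeeping)] -/
private theorem b9_mul_nonneg (hB₃ : 2 * (F.L : ℝ) ^ 2 ≤ B₃) (hB₁ : 0 ≤ B₁) : 0 ≤ b9Of F (F.L ^ 3) B₁ * B₃ :=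
  mul_nonneg (b9Of_pos (F := F) (F.L ^ 3) hB₁).le (floor_nonneg hB₃)

/-- The collar floor `(11·4 + 3·L)·L ≤ L³` (A2's `collar_le_M₁_theta13OfThm1CCM` at `j = 3`, read through `ν.M₁ = L³`). [cite: Balaban1985RegularSpaces, Prop. 6 p.99, (1.130) p.99 (bookkeeping)] -/
private theorem collar_le_cube (ε₀ ε₂₉ B₃ B₃' a₀ a₁' : ℝ) : (11 * 4 + 3 * F.L) * F.L ≤ F.L ^ 3 :=
  (theta13OfThm1CCM_M₁ F 2 3 ε₀ ε₂₉ B₃ B₃' a₀ a₁') ▸ collar_le_M₁_theta13OfThm1CCM F 2 ε₀ ε₂₉ B₃ B₃' a₀ a₁' (le_refl 3)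

end Helpers

section Provisos
variable {B₃ a₀ a₁ B₁ c₁ B₃' a₁' γ ε₀ ε₂₉ : ℝ}

/-- **THE v1.5 PROVISOS `Provisos₁₃SepCoP θ₁₅ᶜᶜᴹ(3;γ)` AT THE WINDOW-EDITION WITNESS FROM THE SIGN-FREE STUB LETTERS (V17)** — K0a `provisos₁₃SepCoP_theta13LiveOfNumerics_of_bgSepCoP` ∘ dag-n21-c Eʷ `bgSepCoPAt_theta13OfThm1CCMW_of_thm1GaugeR_of_hcomp` at `(N, j) := (2, 3)`,
`B₃' := B₉·B₃`, `a₁' := min a₁ (a₀''∕B₃)`, fed by: (8) from [15] Prop. 8's top step (dag-n07-e's bridge ∘ `.of_le`), the R gauge sentence by B′ `variationalThm1GaugeRegSepCoP7MR_of_gauge9TopStepR` at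
dag-n21-c C's `gauge9R_cube_of_prop8TopStep_of_prop6Member` (Prop. 8 ∧ [6] Prop. 6 at NODE 00's member), the floor `(44+3L)L ≤ L³` (A2's collar lemma), `j + 1 ≤ F.m` := `4 ≤ F.m`, the signs (C's
`shrunkCeiling_pos`, FILE 29's `b9Of_pos`), and the two COMPARABILITY clauses (`hcomp`, `hcompRev` — NO monotonicity, NO sign of β) at the window edition by dag-n21-c Dʷ `hcompBoth_theta13OfThm1CCMW_of_betaBoxSignFree_half` from
the two-sided box `bl ≤ β ≤ β'` of `betaOfRecord₁₃ F 2 θ₁₅ᶜᶜᴹ(3)` on `]0,γ]`, `−bl·γ² ≤ 3`, `β'·γ² ≤ ¾`.  Exactly the proviso term inside dag-n21-c Eʷ's ∃-closer `exists_k0SepCoPH_thm1CCMW_of_gauge9TopStepR_of_betaBoxSignFree_half_cube`, exposed AT the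
witness so that the K1-side sockets below read it.  CONDITIONAL on every displayed hypothesis; nothing of Bałaban asserted. [cite: Balaban1985Variational, (6)–(7) p.278, Thm 1 (8)–(9) p.279, (144)–(152) pp.300–301, Prop. 8 p.304; Balaban1985RegularSpaces, (1.3)–(1.9) p.77, Prop. 6 p.99, (1.130) p.99; Balaban1988Convergent, Thm 1 p.262, (2.4)–(2.8) pp.255–256, (2.12)–(2.13) pp.256–257, (3.16)–(3.22) pp.268–269; Balaban1987RG1, Thm 1 p.259, (0.20)–(0.21) p.256, (1.11)–(1.12) p.262, (1.20)–(1.22) p.264; Balaban1989LargeFieldI, (0.3)–(0.4) p.176; Balaban1989LargeFieldII, (1.4) p.357 (bookkeeping)] -/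
theorem provisos₁₃SepCoP_theta13OfThm1CCMW_cube_of_prop8TopStep_of_prop6Member_of_betaBoxSignFree
    (hm : 4 ≤ F.m)
    -- stub 1 `stub_prop8StepCoP13`'s letters: [15] Prop. 8's top step at NODE 00's objects (N07's lane; `2L² ≤ B₃` its inhabitation floor)
    (hB₃ : 2 * (F.L : ℝ) ^ 2 ≤ B₃) (ha₀ : 0 < a₀) (ha₁ : 0 < a₁) (h8 : Prop8RegSepTopStep F 2 (fun ν K Ω => suppDomOfRecord F ν K Ω) B₃ a₀ a₁)
    -- stub 2 `stub_prop6MemberB8At13`'s letters: [6] Prop. 6 at NODE 00's ℤ⁴ cube member (N05∕N06 junction β)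
    (hB₁ : 0 ≤ B₁) (hc₁ : 0 < c₁) (hP6 : letI : CStarAlgebra (MatA 2) := {}; B8.Prop6Printed 4 (F.L : ℝ) B₁ c₁ (fun i : B8LeafModelZd.ZdIdx 4 F.L => zdCub (MatA 2) F.L i))
    -- the witness letters (dag-n21-c FILE C ∕ Cʷ): print's (9) constant `B₃' = B₉·B₃` and the shrunk ceiling `a₁' = min a₁ (a₀''∕B₃)` — two display equations, `rfl` at the closer
    (hB₃' : B₃' = b9Of F (F.L ^ 3) B₁ * B₃) (ha₁' : a₁' = min a₁ (a0Of F 2 (F.L ^ 3) B₁ c₁ / B₃))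
    -- the SIGN-FREE stub 3ᴬ's conclusion at these letters (dag-n21-c Eʷ `…_of_betaBoxSignFree_half_cube`'s binders; plan V17): NODE O's window `γ ∈ ]0, ½]`, `ε₀ ε₂₉`, a TWO-SIDED box
    -- `bl ≤ β ≤ β'` ON `]0, γ]` of `betaOfRecord₁₃ F 2 θ₁₅ᶜᶜᴹ(3)` with `bl` of EITHER sign ([I] Thm 2's «uniformly bounded», p.259; NO sign of β), and the letters `−bl·γ² ≤ 3`, `β'·γ² ≤ ¾`
    (hγ0 : 0 < γ) (hγh : γ ≤ 1 / 2) (hε : 0 < ε₀) (hε' : 0 < ε₂₉) {bl β' : ℝ} (hβlo : BetaLowerH bl γ (betaOfRecord₁₃ F 2 (theta13OfThm1CCM F 2 3 ε₀ ε₂₉ B₃ B₃' a₀ a₁')))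
    (hβhi : BetaUpperH β' γ (betaOfRecord₁₃ F 2 (theta13OfThm1CCM F 2 3 ε₀ ε₂₉ B₃ B₃' a₀ a₁'))) (hl : -bl * γ ^ 2 ≤ 3) (hu : β' * γ ^ 2 ≤ 3 / 4) :
    (theta13OfThm1CCMW F 2 3 γ ε₀ ε₂₉ B₃ B₃' a₀ a₁').Provisos₁₃SepCoP F 2 := by
  subst hB₃' ha₁'
  have H := hcompBoth_theta13OfThm1CCMW_of_betaBoxSignFree_half (F := F) (N := 2) (j := 3) (ε₀ := ε₀) (ε₂₉ := ε₂₉) (B₃ := B₃) (B₃' := (b9Of F (F.L ^ 3) B₁ * B₃)) (a₀ := a₀) (a₁ := (min a₁ (a0Of F 2 (F.L ^ 3) B₁ c₁ / B₃)))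
    hγh (floor_nonneg hB₃) (b9_mul_nonneg hB₃ hB₁) ha₀.le (shrunkCeiling_pos F (F.L ^ 3) (floor_pos hB₃) hB₁ hc₁ ha₁).le hβlo hβhi hl hu
  exact provisos₁₃SepCoP_theta13LiveOfNumerics_of_bgSepCoP F 2 (stage12NumericsOfThm1CCMW F.L 3 γ ε₀ B₃ (b9Of F (F.L ^ 3) B₁ * B₃) a₀ (min a₁ (a0Of F 2 (F.L ^ 3) B₁ c₁ / B₃))) ε₂₉ ⟨3, rfl⟩ (dvd_refl _)
    (bgSepCoPAt_theta13OfThm1CCMW_of_thm1GaugeR_of_hcomp (N := 2) (j := 3) hγ0 hγh hm hε hε' (floor_nonneg hB₃) (b9_mul_nonneg hB₃ hB₁) ha₀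
      (shrunkCeiling_pos F (F.L ^ 3) (floor_pos hB₃) hB₁ hc₁ ha₁)
      (variationalThm1RegSepCoP7M_of_prop8TopStep (floor_pos hB₃) (h8.of_le le_rfl (min_le_left _ _))) (collar_le_cube ε₀ ε₂₉ B₃ (b9Of F (F.L ^ 3) B₁ * B₃) a₀ (min a₁ (a0Of F 2 (F.L ^ 3) B₁ c₁ / B₃)))
      (variationalThm1GaugeRegSepCoP7MR_of_gauge9TopStepR (gauge9R_cube_of_prop8TopStep_of_prop6Member F (floor_pos hB₃) h8 hB₁ hc₁ hP6)) H.1 H.2)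

end Provisos

/-! ## §1 ★★★★ THE K1⁷ v5 RUNG BODY AT THE DOOR-CURED WINDOW-EDITION WITNESS FROM V16's STUB LETTERS (12T-H's cured socket ∘ §0) -/

section RungOfStubsW
variable (B₃ a₀ a₁ B₁ c₁ B₃' a₁' γ ε₀ ε₂₉ : ℝ) (lamW : ResidW F 2)
  (Mstar : ℕ) (ops : OpsY 2 (theta13OfThm1CCMW F 2 3 γ ε₀ ε₂₉ B₃ B₃' a₀ a₁').toStage3Params Mstar) (ζ : ResidZ F 2) (W₀ : B12.RunParams → PrintedCarriers15) (w : WorldP)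

/-- **★★★★ THE K0⁷ → K1⁷ JUNCTION AT THE WINDOW-EDITION WITNESS: THE v5 RUNG BODY AT THE DOOR-CURED `θ₁₅ᶜᶜᴹ(3;γ)(B₃, B₉B₃, a₀, a₁')` WITH ITS K-SIDE = THE SIGN-FREE STUB LETTERS** (plan g77 SIGNFREE-WORD
l.22622: V17 = sign-free 3ᴬ «K0 does not read the sign of β»; the large-torus witness of dag-n21-c Eʷ's sign-free cube closer is THIS door-cured parameter) — 12T-H's generic cured
socket at `Θ := theta13OfNumerics … (stage12NumericsOfThm1CCMW F.L 3 γ ε₀ B₃ B₃' a₀ a₁') …` (whose ₁₃ live re-pin IS `θ₁₅ᶜᶜᴹ(3;γ)` by `rfl`) with `hP := §0`: what the K1⁷ closer of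
`stub_nodes13PWS` needs from the K0 side on the `4 ≤ F.m` branch is EXACTLY stub 1's letters (`2L² ≤ B₃`, `0 < a₀`, `0 < a₁`, [15] Prop. 8's top step `h8`), stub 2's (`0 ≤ B₁`, `0 < c₁`,
[6] Prop. 6 at the member `hP6`), the SIGN-FREE stub's CONCLUSION at the letters `(B₃, B₉·B₃, a₀, min a₁ (a₀''∕B₃))` (the window `0 < γ ≤ ½`, `ε₀ ε₂₉ bl β'`, the two-sided γ-box `bl ≤ β ≤ β'` of
`betaOfRecord₁₃ F 2 θ₁₅ᶜᶜᴹ(3)`, `−bl·γ² ≤ 3`, `β'·γ² ≤ ¾` — node O's 3ᴬ has `bl := −β'`) and `4 ≤ F.m`; N12's §1∕§2 do NOT read the sign of β (the (1.80)∕(1.89) rows enter as RAW displays `h12i180`∕`h12c189`).  N12 (mixed W-pin, 12E) and N13 (dag-n11-e) resolved; the S-bound world binding `hC hγ hL hup` (`w.γ ≤ θ.γ = γ`: the closer's world sits INSIDE NODE O's window),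
rows h05S–h11 ∕ hUV, N12's layer `lamW` with `hsel` and its per-run displays below the torus DISPLAYED.  The conclusion IS the body of the registered `NodesAtSomeRecord13PWS F` (12T-H certificate).
COMPOSITE and CONDITIONAL: nothing of Bałaban asserted, no node discharged, K0⁷ ∕ K1⁷ NOT closed; the `F.m ≤ 3` families are the declared residual (stub 4; 12T-AI at the abstract inhabitant). [cite: Balaban1989LargeFieldII, Thm 1 p.355, (0.1) pp.355–356; Balaban1989LargeFieldI, (0.2)–(0.6) p.176, Prop. 1 (1.78) p.194, (1.80) p.195, (1.89) p.198, (1.99)–(1.102) pp.200–201; Balaban1988Convergent, Thm 1 p.262, (2.4)–(2.13) pp.255–257, (2.18) p.257, (3.16)–(3.25) pp.268–270; Balaban1985Variational, Thm 1 (8)–(9) p.279, (144)–(152) pp.300–301, Prop. 8 p.304; Balaban1985RegularSpaces, (1.3)–(1.9) p.77, Prop. 6 p.99, (1.130) p.99, Thm 8 (1.146) p.101; Balaban1985UV3, Thm 1 p.257, Thm 2 p.272; Balaban1985BackgroundPropagators, Thm 3.1 p.397; Balaban1987RG1, Thm 1 p.259, (0.20)–(0.21) p.256, (1.22) p.264,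 Lemma 4 p.280; Balaban1988RG2Cluster, Lemmas 1–3 pp.9–20 (bookkeeping)] -/
theorem nodesAtSomeRecordS₁₃SepCoPH_of_upS_fourPinW₀_ofHistoryBlind_ofCured_theta13OfThm1CCMW_cube_of_massLive_of_prop8TopStep_of_prop6Member_of_betaBoxSignFree
    (hm : 4 ≤ F.m)
    -- stub 1 `stub_prop8StepCoP13`'s letters: [15] Prop. 8's top step at NODE 00's objects (N07's lane; `2L² ≤ B₃` its inhabitation floor)
    (hB₃ : 2 * (F.L : ℝ) ^ 2 ≤ B₃) (ha₀ : 0 < a₀) (ha₁ : 0 < a₁) (h8 : Prop8RegSepTopStep F 2 (fun ν K Ω => suppDomOfRecord F ν K Ω) B₃ a₀ a₁)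
    -- stub 2 `stub_prop6MemberB8At13`'s letters: [6] Prop. 6 at NODE 00's ℤ⁴ cube member (N05∕N06 junction β)
    (hB₁ : 0 ≤ B₁) (hc₁ : 0 < c₁) (hP6 : letI : CStarAlgebra (MatA 2) := {}; B8.Prop6Printed 4 (F.L : ℝ) B₁ c₁ (fun i : B8LeafModelZd.ZdIdx 4 F.L => zdCub (MatA 2) F.L i))
    -- the witness letters (dag-n21-c FILE C ∕ Cʷ): print's (9) constant `B₃' = B₉·B₃` and the shrunk ceiling `a₁' = min a₁ (a₀''∕B₃)` — two display equations, `rfl` at the closer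
    (hB₃' : B₃' = b9Of F (F.L ^ 3) B₁ * B₃) (ha₁' : a₁' = min a₁ (a0Of F 2 (F.L ^ 3) B₁ c₁ / B₃))
    -- the SIGN-FREE stub 3ᴬ's conclusion at these letters (dag-n21-c Eʷ `…_of_betaBoxSignFree_half_cube`'s binders; plan V17): NODE O's window `γ ∈ ]0, ½]`, `ε₀ ε₂₉`, a TWO-SIDED box
    -- `bl ≤ β ≤ β'` ON `]0, γ]` of `betaOfRecord₁₃ F 2 θ₁₅ᶜᶜᴹ(3)` with `bl` of EITHER sign ([I] Thm 2's «uniformly bounded», p.259; NO sign of β), and the letters `−bl·γ² ≤ 3`, `β'·γ² ≤ ¾`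
    (hγ0 : 0 < γ) (hγh : γ ≤ 1 / 2) (hε : 0 < ε₀) (hε' : 0 < ε₂₉) {bl β' : ℝ} (hβlo : BetaLowerH bl γ (betaOfRecord₁₃ F 2 (theta13OfThm1CCM F 2 3 ε₀ ε₂₉ B₃ B₃' a₀ a₁')))
    (hβhi : BetaUpperH β' γ (betaOfRecord₁₃ F 2 (theta13OfThm1CCM F 2 3 ε₀ ε₂₉ B₃ B₃' a₀ a₁'))) (hl : -bl * γ ^ 2 ≤ 3) (hu : β' * γ ^ 2 ≤ 3 / 4)
    (hW : ∀ P : B12.RunParams, lamW.kSel P < P.K → W₀ P = WOfRecord₁₃ F 2 (theta13OfThm1CCMW F 2 3 γ ε₀ ε₂₉ B₃ B₃' a₀ a₁') lamW P) (hWdeg : ∀ P : B12.RunParams, P.K ≤ lamW.kSel P → B15Leaf (W₀ P))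
    (hC : w.C = (datumOfRecord₁₃SepCoPH F 2 (Stage13HParams.ofHistoryBlind F 2 (Stage13RParams.ofCured F 2 (theta13OfThm1CCMW F 2 3 γ ε₀ ε₂₉ B₃ B₃' a₀ a₁'))) (provisos₁₃SepCoP_theta13OfThm1CCMW_cube_of_prop8TopStep_of_prop6Member_of_betaBoxSignFree hm hB₃ ha₀ ha₁ h8 hB₁ hc₁ hP6 hB₃' ha₁' hγ0 hγh hε hε' hβlo hβhi hl hu).ofCured.ofHistoryBlind).C) (hγ : 0 < w.γ ∧ w.γ ≤ (theta13OfThm1CCMW F 2 3 γ ε₀ ε₂₉ B₃ B₃' a₀ a₁').γ) (hL : w.L = ((theta13OfThm1CCMW F 2 3 γ ε₀ ε₂₉ B₃ B₃' a₀ a₁').L : ℝ))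
    (hup : ∀ P, w.up P = upOfRecord₅CS F 2 ((((((Stage13HParams.ofHistoryBlind F 2 (Stage13RParams.ofCured F 2 (theta13OfThm1CCMW F 2 3 γ ε₀ ε₂₉ B₃ B₃' a₀ a₁'))).toStage5₁₃CoPH F 2).pinB10 F 2).pinY F 2 (Y9OfRecord 2 (theta13OfThm1CCMW F 2 3 γ ε₀ ε₂₉ B₃ B₃' a₀ a₁').toStage3Params Mstar ops)).pinZ F 2 (Z11OfRecord F 2 ζ)).pinW F 2 W₀) P)
    (h05S : ∀ P : B12.RunParams, (upOfRecord₅CS F 2 ((((((Stage13HParams.ofHistoryBlind F 2 (Stage13RParams.ofCured F 2 (theta13OfThm1CCMW F 2 3 γ ε₀ ε₂₉ B₃ B₃' a₀ a₁'))).toStage5₁₃CoPH F 2).pinB10 F 2).pinY F 2 (Y9OfRecord 2 (theta13OfThm1CCMW F 2 3 γ ε₀ ε₂₉ B₃ B₃' a₀ a₁').toStage3Params Mstar ops)).pinZ F 2 (Z11OfRecord F 2 ζ)).pinW F 2 W₀) P).b8)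
    (h06 : B9LeafX (Y9OfRecord 2 (theta13OfThm1CCMW F 2 3 γ ε₀ ε₂₉ B₃ B₃' a₀ a₁').toStage3Params Mstar ops))
    (h07 : B11Leaf (Z11OfRecord F 2 ζ))
    (h08 : PrintedUV3V 2 (theta13OfThm1CCMW F 2 3 γ ε₀ ε₂₉ B₃ B₃' a₀ a₁').L)
    (h09 : ∀ P : B12.RunParams, B12Sec2to5.Lemma4Printed ((theta13OfThm1CCMW F 2 3 γ ε₀ ε₂₉ B₃ B₃' a₀ a₁').res.X P).F12 ((theta13OfThm1CCMW F 2 3 γ ε₀ ε₂₉ B₃ B₃' a₀ a₁').res.X P).c12)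
    (h09T : ∀ P : B12.RunParams, (leavesP w P).smallCouplings → (leavesP w P).smallFieldInductive)
    (h10 : ∀ P : B12.RunParams, B9LeafX (Y9OfRecord 2 (theta13OfThm1CCMW F 2 3 γ ε₀ ε₂₉ B₃ B₃' a₀ a₁').toStage3Params Mstar ops) →
      (B10.Thm1PrintedCompact (((((((Stage13HParams.ofHistoryBlind F 2 (Stage13RParams.ofCured F 2 (theta13OfThm1CCMW F 2 3 γ ε₀ ε₂₉ B₃ B₃' a₀ a₁'))).toStage5₁₃CoPH F 2).pinB10 F 2).pinY F 2 (Y9OfRecord 2 (theta13OfThm1CCMW F 2 3 γ ε₀ ε₂₉ B₃ B₃' a₀ a₁').toStage3Params Mstar ops)).pinZ F 2 (Z11OfRecord F 2 ζ)).pinW F 2 W₀).res.X P).runs10 ∧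
          B10.Thm2Printed (((((((Stage13HParams.ofHistoryBlind F 2 (Stage13RParams.ofCured F 2 (theta13OfThm1CCMW F 2 3 γ ε₀ ε₂₉ B₃ B₃' a₀ a₁'))).toStage5₁₃CoPH F 2).pinB10 F 2).pinY F 2 (Y9OfRecord 2 (theta13OfThm1CCMW F 2 3 γ ε₀ ε₂₉ B₃ B₃' a₀ a₁').toStage3Params Mstar ops)).pinZ F 2 (Z11OfRecord F 2 ζ)).pinW F 2 W₀).res.X P).runs10) →
        B11Leaf (Z11OfRecord F 2 ζ) → B12Sec2to5.Lemma4Printed ((theta13OfThm1CCMW F 2 3 γ ε₀ ε₂₉ B₃ B₃' a₀ a₁').res.X P).F12 ((theta13OfThm1CCMW F 2 3 γ ε₀ ε₂₉ B₃ B₃' a₀ a₁').res.X P).c12 →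
          B13.Lemma1Printed ((theta13OfThm1CCMW F 2 3 γ ε₀ ε₂₉ B₃ B₃' a₀ a₁').res.X P).S13 ((theta13OfThm1CCMW F 2 3 γ ε₀ ε₂₉ B₃ B₃' a₀ a₁').res.X P).c13 ∧ B13.Lemma2Printed ((theta13OfThm1CCMW F 2 3 γ ε₀ ε₂₉ B₃ B₃' a₀ a₁').res.X P).S13 ((theta13OfThm1CCMW F 2 3 γ ε₀ ε₂₉ B₃ B₃' a₀ a₁').res.X P).c13 ∧
            B13.Lemma3Printed ((theta13OfThm1CCMW F 2 3 γ ε₀ ε₂₉ B₃ B₃' a₀ a₁').res.X P).S13 ((theta13OfThm1CCMW F 2 3 γ ε₀ ε₂₉ B₃ B₃' a₀ a₁').res.X P).c13)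
    (h11 : ∀ P : B12.RunParams, (leavesP w P).b7 → (leavesP w P).b8 → (leavesP w P).b9 → (leavesP w P).b10 → (leavesP w P).b11 →
      (leavesP w P).smallCouplings → (leavesP w P).smallFieldInductive → (leavesP w P).flowControl →
        ∀ k, k < P.K → SLaw₁₃CoPH F 2 (Stage13HParams.ofHistoryBlind F 2 (Stage13RParams.ofCured F 2 (theta13OfThm1CCMW F 2 3 γ ε₀ ε₂₉ B₃ B₃' a₀ a₁'))) P k → TLaw₁₃CoPH F 2 (Stage13HParams.ofHistoryBlind F 2 (Stage13RParams.ofCured F 2 (theta13OfThm1CCMW F 2 3 γ ε₀ ε₂₉ B₃ B₃' a₀ a₁'))) P k)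
    (hUV : ∀ P : B12.RunParams, (genFlow (betaOfRecord₁₃ F 2 (theta13OfThm1CCMW F 2 3 γ ε₀ ε₂₉ B₃ B₃' a₀ a₁')) P.g0).InInterval w.γ P.K → ∀ k, k ≤ P.K → SLaw₁₃CoPH F 2 (Stage13HParams.ofHistoryBlind F 2 (Stage13RParams.ofCured F 2 (theta13OfThm1CCMW F 2 3 γ ε₀ ε₂₉ B₃ B₃' a₀ a₁'))) P k →
      ∀ U : GaugeField (F.P P.K) k (SU 2),
        chiβOfRecord₁₃ F 2 (theta13OfThm1CCMW F 2 3 γ ε₀ ε₂₉ B₃ B₃' a₀ a₁') P.K (gOfRecord₁₃ F 2 (theta13OfThm1CCMW F 2 3 γ ε₀ ε₂₉ B₃ B₃' a₀ a₁') P) k U *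
              Real.exp (-(1 / (gOfRecord₁₃ F 2 (theta13OfThm1CCMW F 2 3 γ ε₀ ε₂₉ B₃ B₃' a₀ a₁') P k) ^ 2 * wilsonBGOfRecord F 2 (theta13OfThm1CCMW F 2 3 γ ε₀ ε₂₉ B₃ B₃' a₀ a₁').εbg P k U)
                - w.em (gOfRecord₁₃ F 2 (theta13OfThm1CCMW F 2 3 γ ε₀ ε₂₉ B₃ B₃' a₀ a₁') P k) * (Fintype.card (Site (F.P P.K) k) : ℝ)) ≤ densOfRecord₁₃ F 2 (theta13OfThm1CCMW F 2 3 γ ε₀ ε₂₉ B₃ B₃' a₀ a₁') P k U ∧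
        densOfRecord₁₃ F 2 (theta13OfThm1CCMW F 2 3 γ ε₀ ε₂₉ B₃ B₃' a₀ a₁') P k U ≤ Real.exp (w.ep (gOfRecord₁₃ F 2 (theta13OfThm1CCMW F 2 3 γ ε₀ ε₂₉ B₃ B₃' a₀ a₁') P k) * (Fintype.card (Site (F.P P.K) k) : ℝ)))
    (h12pin : ∀ P : B12.RunParams, lamW.kSel P < P.K → lamW.D1100 P
      = rPrimeDataOfSel (reprTOfRecord₁₃ F 2 (theta13OfThm1CCMW F 2 3 γ ε₀ ε₂₉ B₃ B₃' a₀ a₁') P (lamW.kSel P))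
          ((theta13OfThm1CCMW F 2 3 γ ε₀ ε₂₉ B₃ B₃' a₀ a₁').ppSel P (gOfRecord₁₃ F 2 (theta13OfThm1CCMW F 2 3 γ ε₀ ε₂₉ B₃ B₃' a₀ a₁') P) (lamW.kSel P + 1))
          (fibOfSeq F (theta13OfThm1CCMW F 2 3 γ ε₀ ε₂₉ B₃ B₃' a₀ a₁').ν (theta13OfThm1CCMW F 2 3 γ ε₀ ε₂₉ B₃ B₃' a₀ a₁').τ9 P (gOfRecord₁₃ F 2 (theta13OfThm1CCMW F 2 3 γ ε₀ ε₂₉ B₃ B₃' a₀ a₁') P) (lamW.kSel P + 1)))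
    (h12mass : ∀ P : B12.RunParams, lamW.kSel P < P.K → ∀ s, LiveSeq F 2 (theta13OfThm1CCMW F 2 3 γ ε₀ ε₂₉ B₃ B₃' a₀ a₁').ν (theta13OfThm1CCMW F 2 3 γ ε₀ ε₂₉ B₃ B₃' a₀ a₁').τ9 P (gOfRecord₁₃ F 2 (theta13OfThm1CCMW F 2 3 γ ε₀ ε₂₉ B₃ B₃' a₀ a₁') P) (lamW.kSel P + 1)
        (slotsTOfRecord F 2 (theta13OfThm1CCMW F 2 3 γ ε₀ ε₂₉ B₃ B₃' a₀ a₁').ν (theta13OfThm1CCMW F 2 3 γ ε₀ ε₂₉ B₃ B₃' a₀ a₁').τ9 (EOfRecord₁₃ F 2 (theta13OfThm1CCMW F 2 3 γ ε₀ ε₂₉ B₃ B₃' a₀ a₁')) (wOfRecord₉ F 2 (theta13OfThm1CCMW F 2 3 γ ε₀ ε₂₉ B₃ B₃' a₀ a₁').toStage9Params)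
          (theta13OfThm1CCMW F 2 3 γ ε₀ ε₂₉ B₃ B₃' a₀ a₁').ppSel P (gOfRecord₁₃ F 2 (theta13OfThm1CCMW F 2 3 γ ε₀ ε₂₉ B₃ B₃' a₀ a₁') P) (lamW.kSel P + 1)) s →
      0 < ∫ V, rterm (reprTOfRecord₁₃ F 2 (theta13OfThm1CCMW F 2 3 γ ε₀ ε₂₉ B₃ B₃' a₀ a₁') P (lamW.kSel P)) s V ∂(fieldMeasure (F.P P.K) (lamW.kSel P + 1) (SU 2)))
    (h12P1 : ∀ P : B12.RunParams, lamW.kSel P < P.K → Prop1Printed (lamW.LF P))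
    (h12i180 : ∀ P : B12.RunParams, lamW.kSel P < P.K → ∀ U, new189 (lamW.D189 P) U → ∀ i, (lamW.D189 P).h ≤ i → i ≤ (lamW.D189 P).k →
      ∀ q ∈ plaqsOf (dom (lamW.D189 P) i),
        Ineq180 ((lamW.D189 P).dev0 U q) ((lamW.D189 P).ε (lamW.D189 P).k) (lamW.D189 P).η (lamW.D189 P).B₃ (lamW.D189 P).B₅ (lamW.D189 P).M (lamW.D189 P).δ
          ((lamW.D189 P).dist q) (lamW.D189 P).O1)
    (h12c189 : ∀ P : B12.RunParams, lamW.kSel P < P.K → Claim189 (new189 (lamW.D189 P)) (chiPP (lamW.D189 P)))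
    (hsel : ∀ P : B12.RunParams, 1 ≤ P.K → lamW.kSel P < P.K) :
    ∃ (θ' : Stage13HParams F 2) (h' : θ'.Provisos₁₃SepCoPH F 2) (w : WorldP), (θ'.ZhUnity F 2 ∧ θ'.SlotsNondegenerate₁₃ F 2) ∧ θ'.Admissible F 2 ∧
      (∃ (θ'' : Stage13HParams F 2) (h'' : θ''.Provisos₁₃SepCoPH F 2), θ''.Admissible F 2 ∧
        datumOfRecord₁₃SepCoPH F 2 θ' h' = datumOfRecord₁₃SepCoPH F 2 θ'' h'' ∧ w.C = (datumOfRecord₁₃SepCoPH F 2 θ' h').C ∧ (0 < w.γ ∧ w.γ ≤ θ''.γ) ∧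
        w.L = (θ''.L : ℝ) ∧ ∀ P : B12.RunParams, w.up P = upOfRecord₅CS F 2 (θ''.toStage5₁₃CoPH F 2) P) ∧
      (∀ P : B12.RunParams, Nodes (leavesP w P)) ∧ PrintedUV3V 2 θ'.L ∧
      ∃ lam : ResidW F 2, (∀ P : B12.RunParams, 1 ≤ P.K → lam.kSel P < P.K) ∧
        ∀ P : B12.RunParams, lam.kSel P < P.K → ((leavesP w P).rBasicStep ↔ B15Leaf (WOfRecord₁₃ F 2 θ'.toStage13Params lam P)) := by
  subst hB₃' ha₁'
  exact nodesAtSomeRecordS₁₃SepCoPH_of_upS_fourPinW₀_ofHistoryBlind_ofCured_liveRepin₁₃_of_massLive_of_hasResiduals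
    (theta13OfNumerics F 2 (stage12NumericsOfThm1CCMW F.L 3 γ ε₀ B₃ (b9Of F (F.L ^ 3) B₁ * B₃) a₀ (min a₁ (a0Of F 2 (F.L ^ 3) B₁ c₁ / B₃))) ε₂₉ (zeta316OfRecord F 2 (stage12NumericsOfThm1CCMW F.L 3 γ ε₀ B₃ (b9Of F (F.L ^ 3) B₁ * B₃) a₀ (min a₁ (a0Of F 2 (F.L ^ 3) B₁ c₁ / B₃))).ν (stage12NumericsOfThm1CCMW F.L 3 γ ε₀ B₃ (b9Of F (F.L ^ 3) B₁ * B₃) a₀ (min a₁ (a0Of F 2 (F.L ^ 3) B₁ c₁ / B₃))).τ9.M (stage12NumericsOfThm1CCMW F.L 3 γ ε₀ B₃ (b9Of F (F.L ^ 3) B₁ * B₃) a₀ (min a₁ (a0Of F 2 (F.L ^ 3) B₁ c₁ / B₃))).A₁) (RzOfRecord F 2) (ZtOfRecord F 2)) lamW Mstar ops ζ W₀ w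
    (hasResidualsOfRecord_theta13OfNumerics F 2 (stage12NumericsOfThm1CCMW F.L 3 γ ε₀ B₃ (b9Of F (F.L ^ 3) B₁ * B₃) a₀ (min a₁ (a0Of F 2 (F.L ^ 3) B₁ c₁ / B₃))) ε₂₉)
    (provisos₁₃SepCoP_theta13OfThm1CCMW_cube_of_prop8TopStep_of_prop6Member_of_betaBoxSignFree hm hB₃ ha₀ ha₁ h8 hB₁ hc₁ hP6 rfl rfl hγ0 hγh hε hε' hβlo hβhi hl hu)
    (admissible_theta13OfNumerics F 2 (zeta316OfRecord F 2 (stage12NumericsOfThm1CCMW F.L 3 γ ε₀ B₃ (b9Of F (F.L ^ 3) B₁ * B₃) a₀ (min a₁ (a0Of F 2 (F.L ^ 3) B₁ c₁ / B₃))).ν (stage12NumericsOfThm1CCMW F.L 3 γ ε₀ B₃ (b9Of F (F.L ^ 3) B₁ * B₃) a₀ (min a₁ (a0Of F 2 (F.L ^ 3) B₁ c₁ / B₃))).τ9.M (stage12NumericsOfThm1CCMW F.L 3 γ ε₀ B₃ (b9Of F (F.L ^ 3) B₁ * B₃) a₀ (min a₁ (a0Of F 2 (F.L ^ 3) B₁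 c₁ / B₃))).A₁) (RzOfRecord F 2) (ZtOfRecord F 2) (stage12NumericsOfThm1CCMW_pos_of_le_half F.hL.2.le hγ0 hγh hε (floor_nonneg hB₃) (b9_mul_nonneg hB₃ hB₁) ha₀ (shrunkCeiling_pos F (F.L ^ 3) (floor_pos hB₃) hB₁ hc₁ ha₁)) hε')
    (kappa_nonneg_theta13OfThm1CCM F 2 3 ε₀ ε₂₉ B₃ (b9Of F (F.L ^ 3) B₁ * B₃) a₀ (min a₁ (a0Of F 2 (F.L ^ 3) B₁ c₁ / B₃))) (E0_nonneg_theta13OfThm1CCM F 2 3 ε₀ ε₂₉ B₃ (b9Of F (F.L ^ 3) B₁ * B₃) a₀ (min a₁ (a0Of F 2 (F.L ^ 3) B₁ c₁ / B₃))) (B0_nonneg_theta13OfThm1CCM F 2 3 ε₀ ε₂₉ B₃ (b9Of F (F.L ^ 3) B₁ * B₃) a₀ (min a₁ (a0Of F 2 (F.L ^ 3) B₁ c₁ / B₃)))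
    hW hWdeg hC hγ hL hup h05S h06 h07 h08 h09 h09T h10 h11 hUV h12pin h12mass h12P1 h12i180 h12c189 hsel

end RungOfStubsW

/-! ## §2 ★★★★ THE RUNG RESTRICTED TO N12, SAME INPUTS (12V-H's cured ★★ ∘ §0) -/

section N12RungOfStubsW
variable (B₃ a₀ a₁ B₁ c₁ B₃' a₁' γ ε₀ ε₂₉ : ℝ) (lamW : ResidW F 2)

/-- **★★★★ THE RUNG RESTRICTED TO N12 AT THE DOOR-CURED WINDOW-EDITION WITNESS FROM THE SIGN-FREE STUB LETTERS** (12V-H's cured ★★ with `hP := §0`): K-side = stub 1's + stub 2's letters + the sign-free stub's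
conclusion at `(B₃, B₉·B₃, a₀, a₁')` + `4 ≤ F.m`; N12's layer `lamW`, `hsel` and per-run displays below the torus DISPLAYED.  The N12 line of the which-child-blocks table ON V17's SIGN-FREE ROAD.  NOT the
stub; CONDITIONAL; count-neutral. [cite: Balaban1989LargeFieldII, Thm 1 p.355, (0.1) pp.355–356; Balaban1989LargeFieldI, (0.2)–(0.6) p.176, Prop. 1 (1.78) p.194, (1.80) p.195, (1.89) p.198, (1.99)–(1.102) pp.200–201; Balaban1988Convergent, (2.10)–(2.12) p.256, (2.13) p.257, (3.16)–(3.25) pp.268–270; Balaban1985Variational, Thm 1 (8)–(9) p.279, (152) p.301, Prop. 8 p.304; Balaban1985RegularSpaces, (1.3)–(1.9) p.77, Prop. 6 p.99; Balaban1987RG1, Thm 1 p.259, (0.20)–(0.21) p.256, (1.22) p.264 (bookkeeping)] -/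
theorem exists_guarded_recordS₁₃SepCoPH_b15_main_pinnedN12_ofHistoryBlind_ofCured_theta13OfThm1CCMW_cube_of_massLive_of_prop8TopStep_of_prop6Member_of_betaBoxSignFree
    (hm : 4 ≤ F.m)
    -- stub 1 `stub_prop8StepCoP13`'s letters: [15] Prop. 8's top step at NODE 00's objects (N07's lane; `2L² ≤ B₃` its inhabitation floor)
    (hB₃ : 2 * (F.L : ℝ) ^ 2 ≤ B₃) (ha₀ : 0 < a₀) (ha₁ : 0 < a₁) (h8 : Prop8RegSepTopStep F 2 (fun ν K Ω => suppDomOfRecord F ν K Ω) B₃ a₀ a₁)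
    -- stub 2 `stub_prop6MemberB8At13`'s letters: [6] Prop. 6 at NODE 00's ℤ⁴ cube member (N05∕N06 junction β)
    (hB₁ : 0 ≤ B₁) (hc₁ : 0 < c₁) (hP6 : letI : CStarAlgebra (MatA 2) := {}; B8.Prop6Printed 4 (F.L : ℝ) B₁ c₁ (fun i : B8LeafModelZd.ZdIdx 4 F.L => zdCub (MatA 2) F.L i))
    -- the witness letters (dag-n21-c FILE C ∕ Cʷ): print's (9) constant `B₃' = B₉·B₃` and the shrunk ceiling `a₁' = min a₁ (a₀''∕B₃)` — two display equations, `rfl` at the closer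
    (hB₃' : B₃' = b9Of F (F.L ^ 3) B₁ * B₃) (ha₁' : a₁' = min a₁ (a0Of F 2 (F.L ^ 3) B₁ c₁ / B₃))
    -- the SIGN-FREE stub 3ᴬ's conclusion at these letters (dag-n21-c Eʷ `…_of_betaBoxSignFree_half_cube`'s binders; plan V17): NODE O's window `γ ∈ ]0, ½]`, `ε₀ ε₂₉`, a TWO-SIDED box
    -- `bl ≤ β ≤ β'` ON `]0, γ]` of `betaOfRecord₁₃ F 2 θ₁₅ᶜᶜᴹ(3)` with `bl` of EITHER sign ([I] Thm 2's «uniformly bounded», p.259; NO sign of β), and the letters `−bl·γ² ≤ 3`, `β'·γ² ≤ ¾`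
    (hγ0 : 0 < γ) (hγh : γ ≤ 1 / 2) (hε : 0 < ε₀) (hε' : 0 < ε₂₉) {bl β' : ℝ} (hβlo : BetaLowerH bl γ (betaOfRecord₁₃ F 2 (theta13OfThm1CCM F 2 3 ε₀ ε₂₉ B₃ B₃' a₀ a₁')))
    (hβhi : BetaUpperH β' γ (betaOfRecord₁₃ F 2 (theta13OfThm1CCM F 2 3 ε₀ ε₂₉ B₃ B₃' a₀ a₁'))) (hl : -bl * γ ^ 2 ≤ 3) (hu : β' * γ ^ 2 ≤ 3 / 4)
    (h12pin : ∀ P : B12.RunParams, lamW.kSel P < P.K → lamW.D1100 P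
      = rPrimeDataOfSel (reprTOfRecord₁₃ F 2 (theta13OfThm1CCMW F 2 3 γ ε₀ ε₂₉ B₃ B₃' a₀ a₁') P (lamW.kSel P))
          ((theta13OfThm1CCMW F 2 3 γ ε₀ ε₂₉ B₃ B₃' a₀ a₁').ppSel P (gOfRecord₁₃ F 2 (theta13OfThm1CCMW F 2 3 γ ε₀ ε₂₉ B₃ B₃' a₀ a₁') P) (lamW.kSel P + 1))
          (fibOfSeq F (theta13OfThm1CCMW F 2 3 γ ε₀ ε₂₉ B₃ B₃' a₀ a₁').ν (theta13OfThm1CCMW F 2 3 γ ε₀ ε₂₉ B₃ B₃' a₀ a₁').τ9 P (gOfRecord₁₃ F 2 (theta13OfThm1CCMW F 2 3 γ ε₀ ε₂₉ B₃ B₃' a₀ a₁') P) (lamW.kSel P + 1)))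
    (h12mass : ∀ P : B12.RunParams, lamW.kSel P < P.K → ∀ s, LiveSeq F 2 (theta13OfThm1CCMW F 2 3 γ ε₀ ε₂₉ B₃ B₃' a₀ a₁').ν (theta13OfThm1CCMW F 2 3 γ ε₀ ε₂₉ B₃ B₃' a₀ a₁').τ9 P (gOfRecord₁₃ F 2 (theta13OfThm1CCMW F 2 3 γ ε₀ ε₂₉ B₃ B₃' a₀ a₁') P) (lamW.kSel P + 1)
        (slotsTOfRecord F 2 (theta13OfThm1CCMW F 2 3 γ ε₀ ε₂₉ B₃ B₃' a₀ a₁').ν (theta13OfThm1CCMW F 2 3 γ ε₀ ε₂₉ B₃ B₃' a₀ a₁').τ9 (EOfRecord₁₃ F 2 (theta13OfThm1CCMW F 2 3 γ ε₀ ε₂₉ B₃ B₃' a₀ a₁')) (wOfRecord₉ F 2 (theta13OfThm1CCMW F 2 3 γ ε₀ ε₂₉ B₃ B₃' a₀ a₁').toStage9Params)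
          (theta13OfThm1CCMW F 2 3 γ ε₀ ε₂₉ B₃ B₃' a₀ a₁').ppSel P (gOfRecord₁₃ F 2 (theta13OfThm1CCMW F 2 3 γ ε₀ ε₂₉ B₃ B₃' a₀ a₁') P) (lamW.kSel P + 1)) s →
      0 < ∫ V, rterm (reprTOfRecord₁₃ F 2 (theta13OfThm1CCMW F 2 3 γ ε₀ ε₂₉ B₃ B₃' a₀ a₁') P (lamW.kSel P)) s V ∂(fieldMeasure (F.P P.K) (lamW.kSel P + 1) (SU 2)))
    (h12P1 : ∀ P : B12.RunParams, lamW.kSel P < P.K → Prop1Printed (lamW.LF P))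
    (h12i180 : ∀ P : B12.RunParams, lamW.kSel P < P.K → ∀ U, new189 (lamW.D189 P) U → ∀ i, (lamW.D189 P).h ≤ i → i ≤ (lamW.D189 P).k →
      ∀ q ∈ plaqsOf (dom (lamW.D189 P) i),
        Ineq180 ((lamW.D189 P).dev0 U q) ((lamW.D189 P).ε (lamW.D189 P).k) (lamW.D189 P).η (lamW.D189 P).B₃ (lamW.D189 P).B₅ (lamW.D189 P).M (lamW.D189 P).δ
          ((lamW.D189 P).dist q) (lamW.D189 P).O1)
    (h12c189 : ∀ P : B12.RunParams, lamW.kSel P < P.K → Claim189 (new189 (lamW.D189 P)) (chiPP (lamW.D189 P)))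
    (hsel : ∀ P : B12.RunParams, 1 ≤ P.K → lamW.kSel P < P.K) :
    ∃ (θ' : Stage13HParams F 2) (h' : θ'.Provisos₁₃SepCoPH F 2) (w : WorldP), (θ'.ZhUnity F 2 ∧ θ'.SlotsNondegenerate₁₃ F 2) ∧ θ'.Admissible F 2 ∧
      (∃ (θ'' : Stage13HParams F 2) (h'' : θ''.Provisos₁₃SepCoPH F 2), θ''.Admissible F 2 ∧
        datumOfRecord₁₃SepCoPH F 2 θ' h' = datumOfRecord₁₃SepCoPH F 2 θ'' h'' ∧ w.C = (datumOfRecord₁₃SepCoPH F 2 θ' h').C ∧ (0 < w.γ ∧ w.γ ≤ θ''.γ) ∧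
        w.L = (θ''.L : ℝ) ∧ ∀ P : B12.RunParams, w.up P = upOfRecord₅CS F 2 (θ''.toStage5₁₃CoPH F 2) P) ∧
      (∀ P : B12.RunParams, Dag.B15_main (leavesP w P)) ∧
      ∃ lam : ResidW F 2, (∀ P : B12.RunParams, 1 ≤ P.K → lam.kSel P < P.K) ∧
        ∀ P : B12.RunParams, lam.kSel P < P.K → ((leavesP w P).rBasicStep ↔ B15Leaf (WOfRecord₁₃ F 2 θ'.toStage13Params lam P)) := by
  subst hB₃' ha₁'
  exact exists_guarded_recordS₁₃SepCoPH_b15_main_pinnedN12_ofHistoryBlind_ofCured_liveRepin₁₃_of_massLive_of_hasResiduals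
    (theta13OfNumerics F 2 (stage12NumericsOfThm1CCMW F.L 3 γ ε₀ B₃ (b9Of F (F.L ^ 3) B₁ * B₃) a₀ (min a₁ (a0Of F 2 (F.L ^ 3) B₁ c₁ / B₃))) ε₂₉ (zeta316OfRecord F 2 (stage12NumericsOfThm1CCMW F.L 3 γ ε₀ B₃ (b9Of F (F.L ^ 3) B₁ * B₃) a₀ (min a₁ (a0Of F 2 (F.L ^ 3) B₁ c₁ / B₃))).ν (stage12NumericsOfThm1CCMW F.L 3 γ ε₀ B₃ (b9Of F (F.L ^ 3) B₁ * B₃) a₀ (min a₁ (a0Of F 2 (F.L ^ 3) B₁ c₁ / B₃))).τ9.M (stage12NumericsOfThm1CCMW F.L 3 γ ε₀ B₃ (b9Of F (F.L ^ 3) B₁ * B₃) a₀ (min a₁ (a0Of F 2 (F.L ^ 3) B₁ c₁ / B₃))).A₁) (RzOfRecord F 2) (ZtOfRecord F 2)) lamW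
    (hasResidualsOfRecord_theta13OfNumerics F 2 (stage12NumericsOfThm1CCMW F.L 3 γ ε₀ B₃ (b9Of F (F.L ^ 3) B₁ * B₃) a₀ (min a₁ (a0Of F 2 (F.L ^ 3) B₁ c₁ / B₃))) ε₂₉)
    (provisos₁₃SepCoP_theta13OfThm1CCMW_cube_of_prop8TopStep_of_prop6Member_of_betaBoxSignFree hm hB₃ ha₀ ha₁ h8 hB₁ hc₁ hP6 rfl rfl hγ0 hγh hε hε' hβlo hβhi hl hu)
    (admissible_theta13OfNumerics F 2 (zeta316OfRecord F 2 (stage12NumericsOfThm1CCMW F.L 3 γ ε₀ B₃ (b9Of F (F.L ^ 3) B₁ * B₃) a₀ (min a₁ (a0Of F 2 (F.L ^ 3) B₁ c₁ / B₃))).ν (stage12NumericsOfThm1CCMW F.L 3 γ ε₀ B₃ (b9Of F (F.L ^ 3) B₁ * B₃) a₀ (min a₁ (a0Of F 2 (F.L ^ 3) B₁ c₁ / B₃))).τ9.M (stage12NumericsOfThm1CCMW F.L 3 γ ε₀ B₃ (b9Of F (F.L ^ 3) B₁ * B₃) a₀ (min a₁ (a0Of F 2 (F.L ^ 3) B₁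 c₁ / B₃))).A₁) (RzOfRecord F 2) (ZtOfRecord F 2) (stage12NumericsOfThm1CCMW_pos_of_le_half F.hL.2.le hγ0 hγh hε (floor_nonneg hB₃) (b9_mul_nonneg hB₃ hB₁) ha₀ (shrunkCeiling_pos F (F.L ^ 3) (floor_pos hB₃) hB₁ hc₁ ha₁)) hε')
    h12pin h12mass h12P1 h12i180 h12c189 hsel

end N12RungOfStubsW

end Summit.QuantumFields.YangMills.BalabanUVNodes.N12AtTheta13OfThm1CCMWCubeOfStubsSignFree
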